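import Summits.QuantumFields.BalabanUV.Beta.BorderedHessianSlot
import Summits.QuantumFields.BalabanUV.Beta.BorderedHessianStep

/-!
# «SLOT-BHK» at the STEP level — `bhKStepOf d lin Lc j`: an2's step-`j` candidate bordered Hessian `bhKStepAt d ρ Lc j` over the border
# slot `bhKOf d lin Lc` of `BorderedHessianSlot` (t4-ne9-formalise-leaf-03), recovered BY `rfl` at `lin := linAvgAt ρ · Lc` (R-D1-g25-2 (3))

HONEST FRAMING (cell charter, verbatim): «discharging BetaPertH makes Balaban's UV stability UNCONDITIONAL — a real
constructive-QFT result; it is NOT the continuum limit and NOT the Clay problem.»  DERIVED cell leaf (pub-balaban β sub-cell, binder row D1,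
cross-cell idle seat `b2b-balaban-t4-ne7b-formalise-leaf-05` gen 22; sequel to the row-D1 OWNER's leaf row «HP-SYM-SLOTS» ∕ «SLOT-BHK»,
RULING R-D1-g25-2 (3), whose base module `BorderedHessianSlot` (t4-ne9-formalise-leaf-03-g34) leaves the step level out by design); no
statement of Bałaban's papers is typed here, no `[cite:]` tag, no `Prop` fact; it instantiates no binder of the β-function wall by itself.
NOT D1, NOT `BetaPertH`; NOT continuum; NOT Clay.
HONEST DEPENDENCY (cell records, verbatim): «continuum YM on T⁴ ⇐ BetaPertH ∧ nine spine estimates (0/9 proved); BetaPertH ⇐ (D1) ∧ (D4) ∧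
CAP+tail; G-an2-4 gates asym, D1 and NE2/3/4.»

## What is here (a TABLE-SLOT refactor; the landed files stay byte-identical)

`BorderedHessianStep.bhKStepAt d ρ Lc : ℕ → MKer` is the binder `𝕄_j` of the coarse wiring: `bhKAt d ρ Lc` at `j = 0`; at `j + 1` the field block
`wVH (j+1)·E2 (j+1)`, the border `stepScale (j+1)·` that of `bhKAt d ρ Lc`, the multiplier block `0`.  Its only root-reading ingredient is the
border of `bhKAt`, which `BorderedHessianSlot.bhKOf d lin N` already carries as the operator slot `lin`.  Here:
* §1 **`bhKStepOf d lin Lc j`** := `bhKStepAt` with `bhKAt d ρ Lc ↦ bhKOf d lin Lc`; **`bhKStepOf_linAvgAt : ∀ j, bhKStepOf d (fun A ↦ linAvgAt ρ A Lc) Lc j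
  = bhKStepAt d ρ Lc j` (`rfl` per level)**; `bhKStepOf_zero`; entries `_succ_inl_inl` and the bordered SHAPE `_succ_fm/_mf/_mm` (the `hfm/hmf/hmm`
  hypotheses of the reduced wiring with `s = stepScale`).
* §2 under the SUPPORT and BOUND binders of `BorderedHessianSlot` §3 (`hsupp`, `hbd`): `decays_bhKStepOf_succ` (rate that of `E2 d Lc (j+1)`,
  constant `wVH·C_E + stepScale·(cBH + B)·e^{δ(d+1)2Lc}` — the proof of `decays_bhKStepAt_succ` with `decays_bhKAt ↦ decays_bhKOf`),
  **`spr_bhKStepOf`** (every `j`) — the socket hM of the coarse wiring for `𝕄 := bhKStepOf d lin Lc`, slot-generic.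
* §3 CONSISTENCY (an `example`, no new declaration): `spr_bhKStepAt` re-derived through the slot (binders by `supp_linAvgAt` / `abs_linAvgAt_delta1_le`).
NOT here: anything about rules 3–4 of `RelInv` at `j ≥ 1` (open binder), any JsB12Sym instance, any reflection law.

All declarations `[folklore]`; axioms standard.  Provenance: b2b-balaban β sub-cell, cross-cell seat b2b-balaban-t4-ne7b-formalise-leaf-05 gen 22,
2026-08-21 (v1); over `BorderedHessianSlot` (t4-ne9-formalise-leaf-03-g34) and `BorderedHessianStep` (an2 gen 14) BY NAME; no existing file touched.
-/

open Finset
open scoped BigOperators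
open Literature.MathematicalPhysics.QuantumFieldTheory
open Literature.MathematicalPhysics.QuantumFieldTheory.Balaban1983to89
open Literature.MathematicalPhysics.QuantumFieldTheory.Balaban1983to89.Beta
open Literature.Probability.LatticeModels (Torus.proj)
open B12Sec2to5 (l1 l1_nonneg)
open ExpKernelCalculus (MKer Decays)
open AffineAveraging (Form1 box toSite)
open AveragingContoursRooted (linAvgAt)
open KKTFluctuationKernel (delta1)
open LatticeForm (quo)
open OneStepResolventKernel (Fib decays_mono)
open BalabanStepJetsSucc (E2 decays_E2 wVH)
open Summit.QuantumFields.BalabanUV.Beta.TameKernelCalculus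
open Summit.QuantumFields.BalabanUV.Beta.AxialDressingRooted (cube one_le_of_neZero)

namespace Summit.QuantumFields.BalabanUV.Beta.BorderedHessian

noncomputable section

variable {d : ℕ}

/-! ## §1 The step-`j` candidate over the border slot -/

section Def
variable (d) (lin : Form1 (d + 1) ℝ → Fin (d + 1) → (Fin (d + 1) → ℤ) → ℝ) (Lc : ℕ) [NeZero Lc]

/-- [folklore] **THE STEP-`j` CANDIDATE BORDERED HESSIAN OVER THE BORDER SLOT**: `bhKStepAt d ρ Lc` with `bhKAt d ρ Lc ↦ bhKOf d lin Lc` — at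
`0` the slot kernel; at `j + 1` the field block `wVH (j+1) · E2 (j+1)`, the border `stepScale (j+1) ·` that of `bhKOf d lin Lc`, the
multiplier block `0`.  A definition asserting nothing. -/
def bhKStepOf : ℕ → MKer (d + 1) (Fib d)
  | 0 => bhKOf d lin Lc
  | j + 1 => fun x y a b =>
      match a, b with
      | Sum.inl κ, Sum.inl l => wVH d Lc (j + 1) * E2 d Lc (j + 1) x y (Sum.inl κ) (Sum.inl l)
      | Sum.inl κ, Sum.inr l => stepScale d Lc (j + 1) * bhKOf d lin Lc x y (Sum.inl κ) (Sum.inr l)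
      | Sum.inr κ, Sum.inl l => stepScale d Lc (j + 1) * bhKOf d lin Lc x y (Sum.inr κ) (Sum.inl l)
      | Sum.inr _, Sum.inr _ => 0

variable {d lin Lc}

/-- [folklore] **BRIDGE (`rfl` per level): at the comb's rooted linearised averaging the step slot IS an2's `bhKStepAt`.** -/
@[simp] theorem bhKStepOf_linAvgAt (ρ : Fin (d + 1) → ℤ) : ∀ j : ℕ, bhKStepOf d (fun A => linAvgAt ρ A Lc) Lc j = bhKStepAt d ρ Lc j
  | 0 => rfl
  | _ + 1 => rfl

/-- [folklore] At `j = 0` the step slot is the slot kernel. -/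
@[simp] theorem bhKStepOf_zero : bhKStepOf d lin Lc 0 = bhKOf d lin Lc := rfl

/-- [folklore] Field–field entry at `j + 1` (slot-free). -/
theorem bhKStepOf_succ_inl_inl (j : ℕ) (x y : Fin (d + 1) → ℤ) (κ l : Fin (d + 1)) :
    bhKStepOf d lin Lc (j + 1) x y (Sum.inl κ) (Sum.inl l) = wVH d Lc (j + 1) * E2 d Lc (j + 1) x y (Sum.inl κ) (Sum.inl l) := rfl

/-- [folklore] Field–multiplier entry at `j + 1` (bordered shape `hfm`, `s = stepScale`). -/
theorem bhKStepOf_succ_fm (j : ℕ) (x y : Fin (d + 1) → ℤ) (κ l : Fin (d + 1)) :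
    bhKStepOf d lin Lc (j + 1) x y (Sum.inl κ) (Sum.inr l) = stepScale d Lc (j + 1) * bhKOf d lin Lc x y (Sum.inl κ) (Sum.inr l) := rfl

/-- [folklore] Multiplier–field entry at `j + 1` (bordered shape `hmf`). -/
theorem bhKStepOf_succ_mf (j : ℕ) (x y : Fin (d + 1) → ℤ) (κ l : Fin (d + 1)) :
    bhKStepOf d lin Lc (j + 1) x y (Sum.inr κ) (Sum.inl l) = stepScale d Lc (j + 1) * bhKOf d lin Lc x y (Sum.inr κ) (Sum.inl l) := rfl

/-- [folklore] Multiplier–multiplier entry at `j + 1` vanishes (bordered shape `hmm`). -/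
theorem bhKStepOf_succ_mm (j : ℕ) (x y : Fin (d + 1) → ℤ) (κ l : Fin (d + 1)) :
    bhKStepOf d lin Lc (j + 1) x y (Sum.inr κ) (Sum.inr l) = 0 := rfl

end Def

/-! ## §2 Decay and spread at every level, under the support and bound binders of the slot -/

section Bounds
variable {lin : Form1 (d + 1) ℝ → Fin (d + 1) → (Fin (d + 1) → ℤ) → ℝ} {Lc : ℕ} [NeZero Lc]

/-- [folklore] **THE STEP SLOT DECAYS at `j + 1`** under `hsupp`/`hbd` at blocking `Lc`: rate that of `E2 d Lc (j+1)`, constant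
`wVH·C_E + stepScale·(cBH + B)·e^{δ(d+1)2Lc}` (the proof of `decays_bhKStepAt_succ` with `decays_bhKAt ↦ decays_bhKOf`). -/
theorem decays_bhKStepOf_succ
    (hsupp : ∀ (l : Fin (d + 1)) (y : Fin (d + 1) → ℤ) (κ : Fin (d + 1)) (x : Fin (d + 1) → ℤ),
      Torus.proj Lc x = 0 → lin (delta1 l y) κ (quo Lc x) ≠ 0 → y - x ∈ cube (d + 1) (2 * Lc))
    {B : ℝ} (hB : 0 ≤ B)
    (hbd : ∀ (l : Fin (d + 1)) (y : Fin (d + 1) → ℤ) (κ : Fin (d + 1)) (y' : Fin (d + 1) → ℤ), |lin (delta1 l y) κ y'| ≤ B) (j : ℕ) :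
    ∃ δ C : ℝ, 0 < δ ∧ 0 ≤ C ∧ Decays (bhKStepOf d lin Lc (j + 1)) C δ := by
  obtain ⟨δ, CE, hδ, hCE, hE⟩ := decays_E2 (d := d) (Lc := Lc) (j + 1)
  have hBk := decays_bhKOf (d := d) (one_le_of_neZero Lc) hsupp hB hbd hδ.le
  set CB : ℝ := (cBH d Lc + B) * Real.exp (δ * (((d : ℝ) + 1) * (2 * Lc))) with hCB
  have hCB0 : 0 ≤ CB := mul_nonneg (add_nonneg (cBH_nonneg d Lc) hB) (Real.exp_pos _).le
  have hw : 0 ≤ wVH d Lc (j + 1) := by unfold BalabanStepJetsSucc.wVH; positivity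
  have hs : 0 ≤ stepScale d Lc (j + 1) := (stepScale_pos (j + 1)).le
  refine ⟨δ, wVH d Lc (j + 1) * CE + stepScale d Lc (j + 1) * CB, hδ, by positivity, fun x y a b => ?_⟩
  have hexp : 0 ≤ Real.exp (-δ * l1 (x - y)) := (Real.exp_pos _).le
  have h1 : wVH d Lc (j + 1) * |E2 d Lc (j + 1) x y a b| ≤ wVH d Lc (j + 1) * (CE * Real.exp (-δ * l1 (x - y))) :=
    mul_le_mul_of_nonneg_left (hE x y a b) hw
  have h2 : stepScale d Lc (j + 1) * |bhKOf d lin Lc x y a b| ≤ stepScale d Lc (j + 1) * (CB * Real.exp (-δ * l1 (x - y))) :=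
    mul_le_mul_of_nonneg_left (hBk x y a b) hs
  have hA : 0 ≤ wVH d Lc (j + 1) * (CE * Real.exp (-δ * l1 (x - y))) := by positivity
  have hB' : 0 ≤ stepScale d Lc (j + 1) * (CB * Real.exp (-δ * l1 (x - y))) := by positivity
  rcases a with κ | κ <;> rcases b with l | l
  · rw [bhKStepOf_succ_inl_inl, abs_mul, abs_of_nonneg hw]
    calc wVH d Lc (j + 1) * |E2 d Lc (j + 1) x y (Sum.inl κ) (Sum.inl l)|
        ≤ wVH d Lc (j + 1) * (CE * Real.exp (-δ * l1 (x - y))) := h1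
      _ ≤ wVH d Lc (j + 1) * (CE * Real.exp (-δ * l1 (x - y))) + stepScale d Lc (j + 1) * (CB * Real.exp (-δ * l1 (x - y))) :=
          le_add_of_nonneg_right hB'
      _ = (wVH d Lc (j + 1) * CE + stepScale d Lc (j + 1) * CB) * Real.exp (-δ * l1 (x - y)) := by ring
  · rw [bhKStepOf_succ_fm, abs_mul, abs_of_nonneg hs]
    calc stepScale d Lc (j + 1) * |bhKOf d lin Lc x y (Sum.inl κ) (Sum.inr l)|
        ≤ stepScale d Lc (j + 1) * (CB * Real.exp (-δ * l1 (x - y))) := h2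
      _ ≤ wVH d Lc (j + 1) * (CE * Real.exp (-δ * l1 (x - y))) + stepScale d Lc (j + 1) * (CB * Real.exp (-δ * l1 (x - y))) :=
          le_add_of_nonneg_left hA
      _ = (wVH d Lc (j + 1) * CE + stepScale d Lc (j + 1) * CB) * Real.exp (-δ * l1 (x - y)) := by ring
  · rw [bhKStepOf_succ_mf, abs_mul, abs_of_nonneg hs]
    calc stepScale d Lc (j + 1) * |bhKOf d lin Lc x y (Sum.inr κ) (Sum.inl l)|
        ≤ stepScale d Lc (j + 1) * (CB * Real.exp (-δ * l1 (x - y))) := h2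
      _ ≤ wVH d Lc (j + 1) * (CE * Real.exp (-δ * l1 (x - y))) + stepScale d Lc (j + 1) * (CB * Real.exp (-δ * l1 (x - y))) :=
          le_add_of_nonneg_left hA
      _ = (wVH d Lc (j + 1) * CE + stepScale d Lc (j + 1) * CB) * Real.exp (-δ * l1 (x - y)) := by ring
  · rw [bhKStepOf_succ_mm, abs_zero]
    positivity

/-- [folklore] **THE STEP SLOT IS SPREAD at every level** under `hsupp`/`hbd` — the socket hM of the coarse wiring for `𝕄 := bhKStepOf d lin Lc`. -/
theorem spr_bhKStepOf
    (hsupp : ∀ (l : Fin (d + 1)) (y : Fin (d + 1) → ℤ) (κ : Fin (d + 1)) (x : Fin (d + 1) → ℤ),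
      Torus.proj Lc x = 0 → lin (delta1 l y) κ (quo Lc x) ≠ 0 → y - x ∈ cube (d + 1) (2 * Lc))
    {B : ℝ} (hB : 0 ≤ B)
    (hbd : ∀ (l : Fin (d + 1)) (y : Fin (d + 1) → ℤ) (κ : Fin (d + 1)) (y' : Fin (d + 1) → ℤ), |lin (delta1 l y) κ y'| ≤ B) :
    ∀ j : ℕ, Spr (bhKStepOf d lin Lc j)
  | 0 => by rw [bhKStepOf_zero]; exact spr_bhKOf (one_le_of_neZero Lc) hsupp hB hbd
  | j + 1 => by
    obtain ⟨δ, C, hδ, -, h⟩ := decays_bhKStepOf_succ (d := d) (Lc := Lc) hsupp hB hbd j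
    exact ⟨C, δ, hδ, h⟩

end Bounds

/-! ## §3 The comb instance through the step slot (consistency check; nothing new about the comb) -/

section Comb
variable {Lc : ℕ} [NeZero Lc] {r : Fin (d + 1) → ℕ}

/- [folklore] CONSISTENCY (an `example`, so that an2's landed `spr_bhKStepAt` is not restated): `Spr (bhKStepAt d (toSite r) Lc j)`
re-derived through the step slot (in-block root; binders `supp_linAvgAt` of the base module and an1's `abs_linAvgAt_delta1_le`). -/
example (hr : r ∈ box (d + 1) Lc) (j : ℕ) : Spr (bhKStepAt d (toSite r) Lc j) := by
  rw [← bhKStepOf_linAvgAt]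
  have hLc : 1 ≤ Lc := one_le_of_neZero Lc
  exact spr_bhKStepOf (fun l y κ x hx h => supp_linAvgAt hr l y κ x hx h) (by positivity)
    (fun l y κ y' => abs_linAvgAt_delta1_le hLc hr l y κ y') j

end Comb

end

end Summit.QuantumFields.BalabanUV.Beta.BorderedHessian
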